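import Literature.NumberTheory.EllipticCurves.ShaCorestrictionIndexTwo
import Literature.NumberTheory.EllipticCurves.LocalKummerIsotropyTransport
import Literature.NumberTheory.EllipticCurves.WeilPairingProofs
import HarnessLib

/-!
# Compatible Weil-type pairings along the base change `E/ℚ ↦ E_K/K` (theorems only)

Topic `NumberTheory/EllipticCurves`; namespace `Literature.NumberTheory.EllipticCurves`. Theorems only:
**no definition, no named fact** (D-0026).

The definition-level restriction/corestriction adjointness of the Cassels–Tate pairing
(`casselsTate_canonical_adjoint` clause (vii), `CasselsTateCanonicalAdjoint.lean`; Fisher 2003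
Prop. 2.16) compares Milne's recipe over `ℚ` (Weil pairing `eℚ` on `E[m²](ℚ̄)`, canonical invariant maps of
`ℚ`) with the recipe over `K` (Weil pairing `eK` on `E_K[m²](K̄)`, canonical invariant maps of `K`); the two
Weil-type pairings must be COMPATIBLE along the chosen embedding `ℚ̄ → K̄` (binder `hee`), else the
statement would be false (`eK` versus `eℚ^u`).  This file supplies such a pair from the tree:

* `coe_torsionTransferEquiv_eq_geomPointsEquivBaseChange` — the transfer `torsionTransferEquiv` of
  `LocalKummerIsotropyTransport.lean` and the coefficient isomorphism `geomPointsEquivBaseChange` of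
  `ShaCorestrictionIndexTwo.lean` agree on torsion points (both are `pointsMap` = «`closureEmb` on
  coordinates» followed by an identity-on-coordinates `Affine.Point.congrEquiv`);
* `exists_weilPairing_baseChange_compat` — `∃ eℚ eK`, each bimultiplicative, `μ_m`-valued, alternating,
  non-degenerate and Galois-equivariant, with `eK S' T' = closureEmb (eℚ S T)` for `S' = θ S`, `T' = θ T`:
  `eℚ` from `exists_weilPairing_holds` (Silverman III.8.1), `eK := weilPairingTransfer` (its five
  properties: the tree's `weilPairingTransfer_pow/_add_left/_add_right/_self/_smul` and the
  non-degeneracy proved here).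

Nothing curve-specific is proved; BSD is not advanced.

## References

* [SilvermanAEC2009] J. H. Silverman, *The Arithmetic of Elliptic Curves*, 2nd ed. (2009), Prop. III.8.1.
* [SerreGaloisCohomology1997] J.-P. Serre, *Galois Cohomology*, I §2.4 (compatible pairs, restriction).
-/

noncomputable section

open scoped Classical

namespace Literature.NumberTheory.EllipticCurves

open _root_.WeierstrassCurve Field NumberField Function
open Literature.NumberTheory.GaloisRepresentations

variable (K : Type) [Field K] [NumberField K] (W : WeierstrassCurve ℚ) [W.IsElliptic]

/-- **The two base-change identifications of the tree agree on torsion points**: the transfer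
`torsionTransferEquiv W hn : E[n](ℚ̄) ≃+ E_K[n](K̄)` of `LocalKummerIsotropyTransport.lean` and the
coefficient isomorphism `geomPointsEquivBaseChange K W : E(ℚ̄) ≃+ E_K(K̄)` of
`ShaCorestrictionIndexTwo.lean` are both «the chosen embedding `ℚ̄ → K̄` on coordinates» (`pointsMap`
followed by an identity-on-coordinates `Affine.Point.congrEquiv`). Serre, *Galois Cohomology*, I §2.4
(compatible pairs). [cite: SerreGaloisCohomology1997, I.§2.4] -/
theorem coe_torsionTransferEquiv_eq_geomPointsEquivBaseChange {n : ℤ} (hn : n ≠ 0) (T : geomTorsion W n) :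
    ((W.torsionTransferEquiv (E := K) hn T : geomTorsion (W.baseChange K) n) : geomPoints (W.baseChange K)) =
      geomPointsEquivBaseChange K W T := by
  rw [coe_torsionTransferEquiv_apply, geomPointsEquivBaseChange_apply]
  -- both identifications are identity-on-coordinates transports (`congrEquiv`) of `pointsMap W K T`
  have key : ∀ {A B : WeierstrassCurve (AlgebraicClosure K)} (h₁ : A = B) (h₂ : B = A) (P : B.toAffine.Point),
      (WeierstrassCurve.Affine.Point.congrEquiv h₁).symm P = WeierstrassCurve.Affine.Point.congrEquiv h₂ P := by
    intro A B h₁ h₂ P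
    subst h₁
    rfl
  exact key (baseChange_baseChange W K (AlgebraicClosure K)).symm (baseChange_baseChange W K (AlgebraicClosure K)) _


/-- **Compatible Weil-type pairings over `ℚ` and over `K`.** For an elliptic curve `E = W/ℚ`, a number
field `K` and a level `m ≥ 2` there are a Weil-type pairing `eℚ` on `E[m](ℚ̄)` (bimultiplicative,
`μ_m`-valued, alternating, non-degenerate, `Γ_ℚ`-equivariant: the tree's `exists_weilPairing_holds`,
Silverman *AEC* III.8.1 (a)–(d)) and a Weil-type pairing `eK` on `E_K[m](K̄)` with the same five
properties which is COMPATIBLE with `eℚ` along the base change: `eK S' T' = ι (eℚ S T)` whenever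
`S' = θ S`, `T' = θ T` for the coefficient isomorphism `θ = geomPointsEquivBaseChange K W` and the chosen
embedding `ι = closureEmb : ℚ̄ → K̄` — namely the tree's transported pairing `weilPairingTransfer`
(`LocalKummerIsotropyTransport.lean`; Silverman III.8.1: the Weil pairing is defined over `ℚ̄` and does not
depend on the field of definition), whose non-degeneracy and whose agreement with `θ`
(`coe_torsionTransferEquiv_eq_geomPointsEquivBaseChange`) are proved here.  This is the binder `hee`
(and `hndK`) of `casselsTate_canonical_adjoint` clause (vii) / `exists_ctLevelPairing_resCor_package`
(`CasselsTateCanonicalAdjoint.lean`, `CasselsTateCanonicalResCorPackage.lean`) at `m ↦ m·m`.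
[cite: SilvermanAEC2009, Prop. III.8.1 (a)–(d)] [cite: SerreGaloisCohomology1997, I.§2.4] -/
theorem exists_weilPairing_baseChange_compat (m : ℕ) (hm2 : 2 ≤ m) :
    ∃ (eℚ : geomTorsion W (m : ℤ) → geomTorsion W (m : ℤ) → AlgebraicClosure ℚ)
      (eK : geomTorsion (W.baseChange K) (m : ℤ) → geomTorsion (W.baseChange K) (m : ℤ) →
        AlgebraicClosure K),
      ((∀ S T, eℚ S T ^ m = 1) ∧ (∀ S₁ S₂ T, eℚ (S₁ + S₂) T = eℚ S₁ T * eℚ S₂ T) ∧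
        (∀ S T₁ T₂, eℚ S (T₁ + T₂) = eℚ S T₁ * eℚ S T₂) ∧ (∀ T, eℚ T T = 1) ∧
        (∀ T, (∀ S, eℚ S T = 1) → T = 0) ∧
        (∀ (σ : absoluteGaloisGroup ℚ) (S T : geomTorsion W (m : ℤ)), σ • eℚ S T = eℚ (σ • S) (σ • T))) ∧
      ((∀ S T, eK S T ^ m = 1) ∧ (∀ S₁ S₂ T, eK (S₁ + S₂) T = eK S₁ T * eK S₂ T) ∧
        (∀ S T₁ T₂, eK S (T₁ + T₂) = eK S T₁ * eK S T₂) ∧ (∀ T, eK T T = 1) ∧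
        (∀ T, (∀ S, eK S T = 1) → T = 0) ∧
        (∀ (σ : absoluteGaloisGroup K) (S T : geomTorsion (W.baseChange K) (m : ℤ)),
          σ • eK S T = eK (σ • S) (σ • T))) ∧
      (∀ (S T : geomTorsion W (m : ℤ)) (S' T' : geomTorsion (W.baseChange K) (m : ℤ)),
        (S' : geomPoints (W.baseChange K)) = geomPointsEquivBaseChange K W S →
        (T' : geomPoints (W.baseChange K)) = geomPointsEquivBaseChange K W T →
        (eK S' T' : AlgebraicClosure K) = closureEmb (K := ℚ) K (eℚ S T)) := by
  have hne : ((m : ℕ) : ℚ) ≠ 0 := by exact_mod_cast (show m ≠ 0 by omega)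
  obtain ⟨eℚ, hμ, hadd₁, hadd₂, halt, hnd, hgal⟩ := exists_weilPairing_holds W m hm2 hne
  have hm : (m : ℤ) ≠ 0 := by exact_mod_cast (show m ≠ 0 by omega)
  let A := W.torsionTransferEquiv (E := K) hm
  refine ⟨eℚ, W.weilPairingTransfer m hm eℚ, ⟨hμ, hadd₁, hadd₂, halt, hnd, hgal⟩,
    ⟨W.weilPairingTransfer_pow m hm eℚ hμ, W.weilPairingTransfer_add_left m hm eℚ hadd₁,
      W.weilPairingTransfer_add_right m hm eℚ hadd₂, W.weilPairingTransfer_self m hm eℚ halt, ?_,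
      W.weilPairingTransfer_smul m hm eℚ hgal⟩, ?_⟩
  · -- non-degeneracy transports along the bijection `A` and the injective embedding `ι`
    intro T' hT'
    have h1 : ∀ S : geomTorsion W (m : ℤ), eℚ S (A.symm T') = 1 := fun S ↦ by
      have h := hT' (A S)
      unfold WeierstrassCurve.weilPairingTransfer at h
      rw [AddEquiv.symm_apply_apply] at h
      apply (absClosureEmbedding ℚ K).injective
      rw [map_one]
      exact h
    have h2 : A.symm T' = 0 := hnd _ h1
    simpa using congrArg A h2
  · intro S T S' T' hS hT
    have hS' : S' = A S := Subtype.ext (by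
      rw [hS, coe_torsionTransferEquiv_eq_geomPointsEquivBaseChange])
    have hT'' : T' = A T := Subtype.ext (by
      rw [hT, coe_torsionTransferEquiv_eq_geomPointsEquivBaseChange])
    subst hS' hT''
    unfold WeierstrassCurve.weilPairingTransfer
    rw [AddEquiv.symm_apply_apply, AddEquiv.symm_apply_apply]
    rfl

end Literature.NumberTheory.EllipticCurves

end
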